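import Literature.NumberTheory.Sieve.CoprimeMoebiusHarmonicDecay
import HarnessLib

/-!
# Coprime Möbius harmonic sums over intervals, with and without a logarithm

Topic `Literature/NumberTheory/Sieve`.  Everything in this file is PROVED (theorems only), as corollaries
of the tree's uniform decay bound for `∑_{n ≤ N, (n,k)=1} μ(n)/n`
(`CoprimeMoebiusDecay.abs_sum_coprimeMoebiusInv_le` with `CoprimeMoebiusDecay.exists_abs_moebiusInvSum_le_exp`,
file `CoprimeMoebiusHarmonicDecay.lean`):

* `CoprimeMoebiusIntervals.exists_interval_bound` — there are absolute `c₀ > 0`, `C ≥ 0` with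
  `|∑_{V₁ < n ≤ V₂, (n,k)=1} μ(n)/n| ≤ C · exp(4∑_{p∣k} p^{-3/4}) · exp(−c₀ √log V₁)` for all `k ≥ 1`, `V₁ ≤ V₂`;
* `CoprimeMoebiusIntervals.exists_interval_log_bound` — the same sum weighted by `log n`:
  `|∑_{V₁ < n ≤ V₂, (n,k)=1} μ(n) log n/n| ≤ 2C · exp(4∑_{p∣k} p^{-3/4}) · exp(−c₀ √log V₁) · (1 + log V₂)`
  (Abel summation, the increments `log(n+1) − log n ≥ 0` telescoping).

These interval forms (the constant terms cancel) are the shape in which the prime number theorem for `μ`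
enters dispersion main terms (e.g. Bombieri–Friedlander–Iwaniec, Acta Math. 156 (1986), §§3–4).

## References
* H. L. Montgomery, R. C. Vaughan, *Multiplicative Number Theory I*, CUP 2007, §6.2 and §8.1. [folklore]
-/

noncomputable section

open Finset Real ArithmeticFunction
open scoped ArithmeticFunction.Moebius

namespace Literature.NumberTheory.Sieve

namespace CoprimeMoebiusIntervals

open Literature.NumberTheory.LFunctions.PlateauMollifier
open Literature.NumberTheory.Sieve.CoprimeMoebiusDecay

/-- The `k`-dependence factor `exp(4 ∑_{p ∣ k} p^{-3/4})` of the coprime Möbius decay bound. [folklore] -/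
theorem kFactor_pos (k : ℕ) : 0 < Real.exp (4 * ∑ p ∈ k.primeFactors, (p : ℝ) ^ (-(3 / 4 : ℝ))) :=
  Real.exp_pos _

/-- **Interval form of the coprime Möbius harmonic decay.** There are absolute constants `c₀ > 0`, `C ≥ 0`
such that for every `k ≥ 1` and all `V₁ ≤ V₂`,
`|∑_{V₁ < n ≤ V₂, (n,k)=1} μ(n)/n| ≤ C exp(4∑_{p∣k}p^{-3/4}) exp(−c₀√log V₁)`. [folklore] -/
theorem exists_interval_bound :
    ∃ c₀ : ℝ, 0 < c₀ ∧ ∃ C : ℝ, 0 ≤ C ∧ ∀ (k : ℕ), k ≠ 0 → ∀ (V₁ V₂ : ℕ), V₁ ≤ V₂ →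
      |∑ n ∈ Ioc V₁ V₂, coprimeMoebiusInvAF k n| ≤
        C * Real.exp (4 * ∑ p ∈ k.primeFactors, (p : ℝ) ^ (-(3 / 4 : ℝ))) *
          Real.exp (-c₀ * Real.sqrt (Real.log V₁)) := by
  obtain ⟨c₀, hc₀, C₁, hC₁, hM⟩ := exists_abs_moebiusInvSum_le_exp
  refine ⟨c₀, hc₀, 2 * (C₁ * Real.exp (c₀ ^ 2) * (2 : ℝ) ^ (1 / 4 : ℝ)), by positivity, ?_⟩
  intro k hk V₁ V₂ hV
  set B := Real.exp (4 * ∑ p ∈ k.primeFactors, (p : ℝ) ^ (-(3 / 4 : ℝ))) with hB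
  have h1 := abs_sum_coprimeMoebiusInv_le hc₀ (by linarith) hM hk V₁
  have h2 := abs_sum_coprimeMoebiusInv_le hc₀ (by linarith) hM hk V₂
  -- the sum over `(V₁, V₂]` is the difference of the two prefix sums
  have hsplit : ∑ n ∈ Ioc V₁ V₂, coprimeMoebiusInvAF k n =
      ∑ n ∈ Ioc 0 V₂, coprimeMoebiusInvAF k n - ∑ n ∈ Ioc 0 V₁, coprimeMoebiusInvAF k n := by
    rw [eq_sub_iff_add_eq, add_comm, Finset.sum_Ioc_consecutive _ (Nat.zero_le _) hV]
  rw [hsplit]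
  -- monotonicity of the decay factor: `exp(−c₀√log V₂) ≤ exp(−c₀√log V₁)`
  have hmono : Real.exp (-c₀ * Real.sqrt (Real.log V₂)) ≤ Real.exp (-c₀ * Real.sqrt (Real.log V₁)) := by
    apply Real.exp_le_exp.mpr
    have : Real.sqrt (Real.log V₁) ≤ Real.sqrt (Real.log V₂) := by
      apply Real.sqrt_le_sqrt
      rcases Nat.eq_zero_or_pos V₁ with h0 | hpos
      · subst h0
        simp only [Nat.cast_zero, Real.log_zero]
        rcases Nat.eq_zero_or_pos V₂ with h0' | hpos'
        · subst h0'; simp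
        · exact Real.log_nonneg (by exact_mod_cast hpos')
      · exact Real.log_le_log (by exact_mod_cast hpos) (by exact_mod_cast hV)
    nlinarith
  set A := C₁ * Real.exp (c₀ ^ 2) * (2 : ℝ) ^ (1 / 4 : ℝ) with hA
  have hA0 : 0 ≤ A := by positivity
  have hB0 : 0 ≤ B := (Real.exp_pos _).le
  calc |∑ n ∈ Ioc 0 V₂, coprimeMoebiusInvAF k n - ∑ n ∈ Ioc 0 V₁, coprimeMoebiusInvAF k n|
      ≤ |∑ n ∈ Ioc 0 V₂, coprimeMoebiusInvAF k n| + |∑ n ∈ Ioc 0 V₁, coprimeMoebiusInvAF k n| :=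
        abs_sub _ _
    _ ≤ A * B * Real.exp (-c₀ * Real.sqrt (Real.log V₂)) + A * B * Real.exp (-c₀ * Real.sqrt (Real.log V₁)) :=
        add_le_add h2 h1
    _ ≤ A * B * Real.exp (-c₀ * Real.sqrt (Real.log V₁)) + A * B * Real.exp (-c₀ * Real.sqrt (Real.log V₁)) := by
        gcongr
    _ = 2 * A * B * Real.exp (-c₀ * Real.sqrt (Real.log V₁)) := by ring

/-- Telescoping of the logarithm over `V₁ ≤ j < V₂` (with Mathlib's convention `log 0 = 0`). [folklore] -/
theorem sum_Ico_log_succ_sub_log {V₁ V₂ : ℕ} (hV : V₁ ≤ V₂) :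
    ∑ j ∈ Ico V₁ V₂, (Real.log ((j : ℝ) + 1) - Real.log j) = Real.log V₂ - Real.log V₁ := by
  induction V₂ with
  | zero =>
    have : V₁ = 0 := by omega
    subst this; simp
  | succ V ih =>
    rcases Nat.eq_or_lt_of_le hV with heq | hlt
    · rw [← heq]; simp
    · rw [Finset.sum_Ico_succ_top (by omega), ih (by omega)]
      push_cast; ring

/-- Summation by parts over `(V₁, V]` with the weight `log`:
`∑_{V₁<n≤V} aₙ log n = S(V) log V − ∑_{V₁ ≤ j < V} S(j) (log(j+1) − log j)`, `S(u) = ∑_{V₁<n≤u} aₙ`. [folklore] -/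
theorem sum_Ioc_mul_log_eq (a : ℕ → ℝ) {V₁ V : ℕ} (hVV : V₁ ≤ V) :
    ∑ n ∈ Ioc V₁ V, a n * Real.log n =
      (∑ n ∈ Ioc V₁ V, a n) * Real.log V -
        ∑ j ∈ Ico V₁ V, (∑ n ∈ Ioc V₁ j, a n) * (Real.log ((j : ℝ) + 1) - Real.log j) := by
  induction V with
  | zero =>
    have : V₁ = 0 := by omega
    subst this; simp
  | succ V ih =>
    rcases Nat.eq_or_lt_of_le hVV with heq | hlt
    · rw [← heq]; simp
    · have hV' : V₁ ≤ V := by omega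
      rw [Finset.sum_Ioc_succ_top (by omega), ih hV', Finset.sum_Ico_succ_top hV',
        Finset.sum_Ioc_succ_top (by omega)]
      push_cast; ring

/-- Abel summation for a logarithmic weight over an interval: if all partial sums
`∑_{V₁ < n ≤ u} a n` (`V₁ ≤ u ≤ V₂`) are at most `ε` in absolute value, then
`|∑_{V₁ < n ≤ V₂} a n · log n| ≤ 2 ε (1 + log V₂)`. [folklore] -/
theorem abs_sum_mul_log_le_of_partial {a : ℕ → ℝ} {V₁ V₂ : ℕ} (hV : V₁ ≤ V₂) {ε : ℝ} (hε : 0 ≤ ε)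
    (h : ∀ u, V₁ ≤ u → u ≤ V₂ → |∑ n ∈ Ioc V₁ u, a n| ≤ ε) :
    |∑ n ∈ Ioc V₁ V₂, a n * Real.log n| ≤ 2 * ε * (1 + Real.log V₂) := by
  have hlog0 : ∀ m : ℕ, 0 ≤ Real.log (m : ℝ) := fun m => by
    rcases Nat.eq_zero_or_pos m with h0 | hp
    · subst h0; simp
    · exact Real.log_nonneg (by exact_mod_cast hp)
  have hincr : ∀ j : ℕ, 0 ≤ Real.log ((j : ℝ) + 1) - Real.log j := by
    intro j
    rcases Nat.eq_zero_or_pos j with h0 | hp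
    · subst h0; simp
    · have : Real.log (j : ℝ) ≤ Real.log ((j : ℝ) + 1) :=
        Real.log_le_log (by exact_mod_cast hp) (by linarith)
      linarith
  rw [sum_Ioc_mul_log_eq a hV]
  have h1 : |(∑ n ∈ Ioc V₁ V₂, a n) * Real.log V₂| ≤ ε * Real.log V₂ := by
    rw [abs_mul, abs_of_nonneg (hlog0 V₂)]
    exact mul_le_mul_of_nonneg_right (h V₂ hV le_rfl) (hlog0 V₂)
  have h2 : |∑ j ∈ Ico V₁ V₂, (∑ n ∈ Ioc V₁ j, a n) * (Real.log ((j : ℝ) + 1) - Real.log j)| ≤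
      ε * (Real.log V₂ - Real.log V₁) := by
    rw [← sum_Ico_log_succ_sub_log hV, Finset.mul_sum]
    refine (Finset.abs_sum_le_sum_abs _ _).trans (Finset.sum_le_sum fun j hj => ?_)
    rw [abs_mul, abs_of_nonneg (hincr j)]
    have hjr := Finset.mem_Ico.mp hj
    exact mul_le_mul_of_nonneg_right (h j hjr.1 hjr.2.le) (hincr j)
  have h3 : ε * (Real.log V₂ - Real.log V₁) ≤ ε * Real.log V₂ := by
    have := hlog0 V₁; nlinarith
  calc |(∑ n ∈ Ioc V₁ V₂, a n) * Real.log V₂ -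
        ∑ j ∈ Ico V₁ V₂, (∑ n ∈ Ioc V₁ j, a n) * (Real.log ((j : ℝ) + 1) - Real.log j)|
      ≤ ε * Real.log V₂ + ε * Real.log V₂ := (abs_sub _ _).trans (add_le_add h1 (h2.trans h3))
    _ ≤ 2 * ε * (1 + Real.log V₂) := by nlinarith [hlog0 V₂]

/-- **Interval form with a logarithm.** With the constants of `exists_interval_bound`:
`|∑_{V₁ < n ≤ V₂, (n,k)=1} μ(n) log n / n| ≤ 2C exp(4∑_{p∣k}p^{-3/4}) exp(−c₀√log V₁) (1 + log V₂)`. [folklore] -/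
theorem exists_interval_log_bound :
    ∃ c₀ : ℝ, 0 < c₀ ∧ ∃ C : ℝ, 0 ≤ C ∧ ∀ (k : ℕ), k ≠ 0 → ∀ (V₁ V₂ : ℕ), V₁ ≤ V₂ →
      |∑ n ∈ Ioc V₁ V₂, coprimeMoebiusInvAF k n| ≤
        C * Real.exp (4 * ∑ p ∈ k.primeFactors, (p : ℝ) ^ (-(3 / 4 : ℝ))) *
          Real.exp (-c₀ * Real.sqrt (Real.log V₁)) ∧
      |∑ n ∈ Ioc V₁ V₂, coprimeMoebiusInvAF k n * Real.log n| ≤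
        2 * (C * Real.exp (4 * ∑ p ∈ k.primeFactors, (p : ℝ) ^ (-(3 / 4 : ℝ))) *
          Real.exp (-c₀ * Real.sqrt (Real.log V₁))) * (1 + Real.log V₂) := by
  obtain ⟨c₀, hc₀, C, hC, hB⟩ := exists_interval_bound
  refine ⟨c₀, hc₀, C, hC, fun k hk V₁ V₂ hV => ⟨hB k hk V₁ V₂ hV, ?_⟩⟩
  refine abs_sum_mul_log_le_of_partial hV (by positivity) fun u hu1 _ => ?_
  exact hB k hk V₁ u hu1

end CoprimeMoebiusIntervals

end Literature.NumberTheory.Sieve
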